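import Literature.MathematicalPhysics.QuantumFieldTheory.BalabanImbrieJaffe1984to88.BIJ88PolymerRep5134

/-!
# `BalabanImbrieJaffe1984to88.BIJ88MayerExchange5134` — T. Bałaban, J. Imbrie, A. Jaffe, *Effective action and cluster properties of the
abelian Higgs model*, Commun. Math. Phys. **114** (1988) 257–315 [BalabanImbrieJaffe1988], §5.13 p. 306 [PDF 50]: **display (5.13.4), its
RIGHT-HAND equality — the exchange of the Mayer sums `Σ_{S_Y}Σ_{S_5}` with the sum over the fillings `{X_α}`**, *"= e^{−V^{(k)}_{const}(Λ^{(k)}_8)}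
Σ_{{X_α}} Π_α g₂(X_α). (5.13.4) Here g₂(X_α) is obtained by summing over S_Y, S_5 compatible with X_α (each Y, X is contained in X_α or the
corresponding component of Λ^{(k)c}_{11}): g₂(X_α) = Σ_{S_Y,S_5 compatible with X_α} g₁(X_α)"* — DERIVED IN THE HONEST BOOKKEEPING of this
seat's gen-8 files (`BIJ88PolymerRep5134`, GAPS.md G-C2-p25-03): the elementary regions `□_i` of p. 304 DEPEND on the Mayer data `S = (S_Y, S_5)`
(merging rules (i)–(ii)), the left side of (5.13.4) at fixed `S` is the sum over the ADMISSIBLE fillings (cluster configurations) of the set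
`I(S)` of elementary regions, and exchanging `Σ_S` with that sum yields a TWO-SPECIES POLYMER GAS on the cubes of Λ₁₀: fillings `Q` of the cubes by
polymers closed under the `S`-independent rules (iii)–(iv), a sub-family `M ⊆ Q` of MULTI-REGION polymers subject to a hard core (no two of them
abut), weights `Π_{X∈M} g₂ᴮ(X) · Π_{X∈Q∖M} g₂ᴬ(X)` where `g₂ᴬ(X)` / `g₂ᴮ(X)` sum the fixed-Mayer-data activity `g₁(X; T)` over the local Mayer
data `T` (polymers inside `X`) for which `X` is ONE elementary region / a union of AT LEAST TWO; the printed all-fillings form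
`Σ_{{X_α}} Π_α g₂(X_α)`, `g₂ = g₂ᴬ + g₂ᴮ = Σ_{T compatible} g₁`, equals this plus the terms with two abutting multi-region polymers (which the
cube-wise decoupling expansion never produces). THIS FILE: the objects, the fixed-Mayer-data bijection and the local form of the constraints;
the exchange theorems are in the companion `BIJ88Eq5134TwoSpecies`.

statement-level skeleton of published theorems with citation tags; proofs where landed; nothing here is a claim about the Yang–Mills mass gap

PDF held: `paper:balaban1988-cmp114-bij-abelian-higgs-effective-action` (journal page = PDF page + 256); p. 304 = PDF 48, p. 306 = PDF 50, p. 307 =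
PDF 51 (p. 306/307 rendered and read as images this session, `renders/original-p050-x2.png`, `…p051-x2.png` of the p25 seat; text `p0048.txt`,
`p0050.txt`).

**The print (verbatim).** p. 304 [PDF 48]: *"We decompose Λ^{(k)}_{10} into elementary regions {□_i}_{i∈I} which are connected unions of □^{(α)}.
Two □^{(α)} are included into a □_i if one of the following conditions hold: (i) They are both in some Y, Y ∈ S_Y, (ii) They are both in some X,
X ∈ S_5, (iii) They both contain sites or bonds within r(e_k) of some X_{σ₁}, σ₁ ∈ σ̃₁. (iv) They are both in a connected component of
Λ^{(k)c}_{11}."* p. 306 [PDF 50]: *"Call the factorization regions clusters. … We obtain the following expressions for the dμ^{(k)}_{Λ^{(k)}_{10}}-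
integral in (5.12.8): Σ_{S_Y}Σ_{S_5} e^{−V^{(k)}_{const}(Λ^{(k)}_8)} Σ_{{X_α} filling Λ^{(k)}_{10}} Π_α g₁(X_α) = e^{−V^{(k)}_{const}(Λ^{(k)}_8)} Σ_{{X_α}}
Π_α g₂(X_α). (5.13.4) Here g₂(X_α) is obtained by summing over S_Y, S_5 compatible with X_α (each Y, X is contained in X_α or the corresponding
component of Λ^{(k)c}_{11}): g₂(X_α) = Σ_{S_Y,S_5 compatible with X_α} g₁(X_α)."* p. 307 [PDF 51]: *"The exceptions are when cubes are in a
component of Λ^{(k)c}_{11}, when they support some F^{m̄}_{k,loc}(X_{σ₁}), or when X_α is a single cube."*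

**The model** (cube-index level, as in this seat's `BIJ88ElementaryRegions304` / `BIJ88Resummation5141` / `BIJ88Clusters5134` / `BIJ88PolymerRep5134`).
Cubes `□^{(α)}` = elements of a type `ι`, `W : Finset ι` = the cubes of Λ^{(k)}_{10}, `adj` = *"abut"* on cubes (any decidable relation). The
MAYER DATA: a finite universe `Ys` of Mayer polymers (the possible `Y ∈ S_Y` and `X ∈ S_5`, as nonempty sets of cubes, entered by their traces on
`W` — `BIJ88ElementaryRegions304` reading (b)), a Mayer set being `S ⊆ polysIn Ys W`; the `S`-INDEPENDENT merging rules (iii)–(iv) are a second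
family `J₀` of joining sets (the r(e_k)-neighbourhoods of the `X_{σ₁}`, the traces of the components of Λ^{(k)c}_{11}; sets of cubes of `W`). The
elementary regions of `S` are `regions (J₀ ∪ S) W` (`BIJ88ElementaryRegions304.regions`), a set partition `I(S)` of `W` into sets of cubes; the
clusters of the decoupling expansion at fixed `S` are sets of elementary regions, two regions abutting when some of their cubes do (`radj adj`);
the fixed-`S` activity of a cluster with cube content `X` and local Mayer data `T` (the polymers of `S` inside `X`) is an arbitrary `g X T : R`
(commutative ring) in §1–§3, and in §4 it is the printed `g₁` of `BIJ88PolymerRep5134` for a family of cluster-factorizing corner expectations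
`z T` on the regions (one for each Mayer data `T`, *"f(□_i) is the product of all the factors … localized in □_i"*), local in the sense that the
expectation over the fields of a union `X` of regions sees only the Mayer polymers inside `X` (*"⟨·⟩_{s_Γ,X} is defined by integrating over the
fields in X only"*).

**What is proved (0 `sorry`, standard axioms, 0 new `Prop` facts; finite identities).**
* §1 `radj` (abutting of regions), `HardCore` (a family of cube polymers no two of which abut), `localI J₀ X T := regions (restrictTo J₀ X ∪ T) X`
  (the elementary regions of the polymer `X` for the rules inside it), `IsMulti` (`X` consists of ≥ 2 of them), the two species of resummed
  activities **`gA`** (`Σ_{T ⊆ 𝒫(X), X one region} g X T`) and **`gB`** (`Σ_{T ⊆ 𝒫(X), X ≥ 2 regions} g X T`), `gA_add_gB` (`= g2 Ys g X`, the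
  printed `g₂ = Σ_{compatible} g₁` of `BIJ88Resummation5141.g2`), `not_isMulti_iff` (for `X ≠ ∅`: one region iff `localI = {X}`).
* §2 FIXED MAYER DATA: `isClosed_biUnion` (a union of elementary regions is closed under the rules), `filter_subset_biUnion` / `biUnion_filter_subset`
  (sets of regions ↔ closed sets of cubes), **`localI_eq_filter`** (LOCALITY: inside a closed polymer `X` the regions for the rules and polymers inside
  `X` are the global regions contained in `X`), and **`sum_admissible_regions_eq`** — the bijection `P ↦ {∪K : K ∈ P}` between the admissible fillings
  of `I(S)` by sets of regions and the fillings `Q` of `W` by `(J₀ ∪ S)`-closed cube polymers no two MULTI-REGION members of which abut, for every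
  weight.
* §3 THE EXCHANGE, LOCAL FORM OF THE CONSTRAINTS: `AdmLoc` (no two polymers multi-region for the Mayer polymers inside them abut),
  `admGlob_iff_admLoc`, **`forall_isClosed_iff_compat`** (all blocks of a filling are `S`-closed iff `S` is compatible with it — *"each Y, X is
  contained in X_α"*), `multiPart` / `admLoc_iff_hardCore_multiPart` (admissibility = the hard core on the multi-region sub-family), the
  species-constrained activity `gM` with `prod_gM_eq`, `g2_gM` (its Mayer resummation is `gB` on the prescribed multi-region family and `gA` off it).
* §4 A SUPPLY of local, cluster-factorizing corner data on the regions: `zLoc` (cluster products of a weight depending on the cube content of a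
  cluster and the Mayer polymers inside it), `isClusterFactorizing_zLoc`, `restrictTo_restrictTo`, `zLoc_local`.
The exchange itself (`exchange5134`), the comparison with the printed all-fillings form (`printed_eq_honest_add`) and the version with the
printed activities `g₁` of cluster-factorizing corner expectations (`eq5134_right`) are the companion file `BIJ88Eq5134TwoSpecies` (same seat,
theorems only).

**Reading note (continuation of GAPS.md G-C2-p25-03 to the `S`-summed display).** (1) Because the □_i depend on `S`, *"{X_α} filling Λ₁₀"* on the
left of (5.13.4) ranges over cluster configurations of `S`-dependent regions; after the exchange the `S`-independent residue of the constraint is: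
the `X_α` are unions of the regions of rules (iii)–(iv) alone (`J₀`-closed), and no two `X_α` that are multi-region FOR THEIR OWN Mayer data abut —
a two-species hard core (single-region polymers, in particular single cubes and the polymers of the p. 307 *"exceptions"*, may abut anything).
(2) With `g₂ := Σ_{compatible} g₁ = gA + gB` the printed `Σ_{{X_α}} Π g₂(X_α)` over all `J₀`-closed fillings equals the expansion plus the
hard-core-violating terms (`printed_eq_honest_add`); it is exact iff those vanish. (3) *"or the corresponding component of Λ^{(k)c}_{11}"*: a Mayer
polymer meeting Λ₁₀ only through a component of Λ₁₁ᶜ is entered by its trace, which rule (iv) places inside one region — covered; a polymer with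
empty trace on Λ₁₀ carries no cube and is outside the model (its factor rides with the component's region, p. 304). NOT summit progress; NOT
continuum; NOT Clay. Imports: `BIJ88PolymerRep5134` only; modifies nothing. Cell `lit-balaban` Phase 2, seat p25 gen 9; row C2.Eq5.13.3-5.13.4
(owner r16, referee ref-5).
-/

open Finset
open Literature.Probability.LatticeModels (IsSetPartition setPartitions mem_setPartitions)
open Literature.MathematicalPhysics.QuantumFieldTheory.BalabanImbrieJaffe1984to88.BIJ88ElementaryRegions304
  (IsClosed region regions mem_region mem_region_self region_subset region_subset_of_isClosed isClosed_region inter_subset_region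
   region_eq_of_mem isSetPartition_regions mem_regions region_mem_regions regions_restrict_of_isClosed)
open Literature.MathematicalPhysics.QuantumFieldTheory.BalabanImbrieJaffe1984to88.BIJ88Resummation5141
  (polysIn mem_polysIn Compat restrictTo mem_restrictTo g2 sum_compat_prod_eq_prod_g2 filter_compat_polysIn)
open Literature.MathematicalPhysics.QuantumFieldTheory.BalabanImbrieJaffe1984to88.BIJ88Clusters5134
open Literature.MathematicalPhysics.QuantumFieldTheory.BalabanImbrieJaffe1984to88.BIJ88PolymerRep5134

namespace Literature.MathematicalPhysics.QuantumFieldTheory.BalabanImbrieJaffe1984to88.BIJ88MayerExchange5134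

variable {ι : Type*} [DecidableEq ι]

/-! ## §1 Regions abutting, the hard core, the local elementary regions of a polymer, the two species of resummed activities -/

section Species

variable (adj : ι → ι → Prop) [DecidableRel adj] {R : Type*} [CommRing R]

/-- p. 306 [PDF 50]: *"(Here we say that □_i is connected to □_{i′} if they abut on a hypersurface of any dimension.)"* — two elementary regions
(sets of cubes) ABUT when some cube of the one abuts some cube of the other. [cite: BalabanImbrieJaffe1988, p.306 (Sect. 5.13)] -/
def radj (K K' : Finset ι) : Prop := ∃ a ∈ K, ∃ b ∈ K', adj a b

/-- decidability of `radj`. [cite: BalabanImbrieJaffe1988, p.306 (Sect. 5.13)] -/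
instance instDecidableRelRadj : DecidableRel (radj adj) := fun K K' =>
  inferInstanceAs (Decidable (∃ a ∈ K, ∃ b ∈ K', adj a b))

/-- the HARD CORE of the resummed expansion: a family `M` of cube polymers no two distinct members of which contain abutting cubes (the
multi-region clusters of one decoupling expansion never abut — they would be one cluster, p. 306). [cite: BalabanImbrieJaffe1988, (5.13.4) p.306] -/
def HardCore (M : Finset (Finset ι)) : Prop := ∀ X ∈ M, ∀ X' ∈ M, X ≠ X' → ∀ a ∈ X, ∀ b ∈ X', ¬ adj a b

/-- decidability of `HardCore`. [cite: BalabanImbrieJaffe1988, (5.13.4) p.306] -/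
instance instDecidableHardCore (M : Finset (Finset ι)) : Decidable (HardCore adj M) :=
  inferInstanceAs (Decidable (∀ X ∈ M, ∀ X' ∈ M, X ≠ X' → ∀ a ∈ X, ∀ b ∈ X', ¬ adj a b))

variable {adj}

omit [DecidableEq ι] [DecidableRel adj] in
/-- sub-families of a hard-core family are hard-core. [cite: BalabanImbrieJaffe1988, (5.13.4) p.306] -/
theorem HardCore.mono {M M' : Finset (Finset ι)} (h : HardCore adj M) (hM' : M' ⊆ M) : HardCore adj M' :=
  fun X hX X' hX' hne a ha b hb => h X (hM' hX) X' (hM' hX') hne a ha b hb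

omit [DecidableEq ι] [DecidableRel adj] in
/-- the empty family is hard-core. [cite: BalabanImbrieJaffe1988, (5.13.4) p.306] -/
theorem hardCore_empty : HardCore adj (∅ : Finset (Finset ι)) := fun X hX => absurd hX (notMem_empty X)

variable (J₀ : Finset (Finset ι))

/-- **the elementary regions of a polymer for the rules inside it** (p. 304 rules (i)–(iv) restricted to the polymer `X`; p. 306 *"S_Y, S_5
compatible with X_α (each Y, X is contained in X_α …)"*): the regions of the cube set `X` for the joining family made of the `S`-independent
joining sets inside `X` (rules (iii)–(iv), `restrictTo J₀ X`) and the local Mayer data `T` (rules (i)–(ii)).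
[cite: BalabanImbrieJaffe1988, p.304 (Sect. 5.13)] -/
def localI (X : Finset ι) (T : Finset (Finset ι)) : Finset (Finset ι) := regions (restrictTo J₀ X ∪ T) X

/-- the polymer `X` with local Mayer data `T` is MULTI-REGION: it consists of at least two elementary regions (species B; species A = exactly one
region, which includes the p. 307 *"exceptions … when cubes are in a component of Λ^{(k)c}_{11}, when they support some F^{m̄}_{k,loc}(X_{σ₁}), or
when X_α is a single cube"*). [cite: BalabanImbrieJaffe1988, p.307 (Sect. 5.13)] -/
def IsMulti (X : Finset ι) (T : Finset (Finset ι)) : Prop := 2 ≤ (localI J₀ X T).card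

/-- decidability of `IsMulti`. [cite: BalabanImbrieJaffe1988, p.307 (Sect. 5.13)] -/
instance instDecidableIsMulti (X : Finset ι) (T : Finset (Finset ι)) : Decidable (IsMulti J₀ X T) :=
  inferInstanceAs (Decidable (2 ≤ (localI J₀ X T).card))

variable (Ys : Finset (Finset ι))

/-- **species A of the resummed activity**, `g₂ᴬ(X) := Σ_{T ⊆ 𝒫(X): X a single elementary region of T} g₁(X; T)` — the part of the printed
*"g₂(X_α) = Σ_{S_Y,S_5 compatible with X_α} g₁(X_α)"* coming from Mayer data for which `X_α` is ONE elementary region.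
[cite: BalabanImbrieJaffe1988, (5.13.4) p.306] -/
def gA (g : Finset ι → Finset (Finset ι) → R) (X : Finset ι) : R :=
  ∑ T ∈ (polysIn Ys X).powerset with ¬ IsMulti J₀ X T, g X T

/-- **species B of the resummed activity**, `g₂ᴮ(X) := Σ_{T ⊆ 𝒫(X): X ≥ 2 elementary regions of T} g₁(X; T)` — the part of the printed `g₂(X_α)`
coming from Mayer data for which `X_α` is a union of AT LEAST TWO elementary regions (a genuine cluster of the decoupling expansion).
[cite: BalabanImbrieJaffe1988, (5.13.4) p.306] -/
def gB (g : Finset ι → Finset (Finset ι) → R) (X : Finset ι) : R :=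
  ∑ T ∈ (polysIn Ys X).powerset with IsMulti J₀ X T, g X T

/-- **`g₂ = g₂ᴬ + g₂ᴮ`**: the two species together are the printed *"g₂(X_α) = Σ_{S_Y,S_5 compatible with X_α} g₁(X_α)"* (`BIJ88Resummation5141.g2`:
the sum over ALL local Mayer data). [cite: BalabanImbrieJaffe1988, (5.13.4) p.306] -/
theorem gA_add_gB (g : Finset ι → Finset (Finset ι) → R) (X : Finset ι) : gA J₀ Ys g X + gB J₀ Ys g X = g2 Ys g X := by
  rw [gA, gB, g2, add_comm, sum_filter_add_sum_filter_not]

/-- a set partition of a nonempty set with at most one block is the one-block partition. [cite: BalabanImbrieJaffe1988, p.304 (Sect. 5.13)] -/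
theorem eq_singleton_of_card_le_one {X : Finset ι} {π : Finset (Finset ι)} (hπ : IsSetPartition X π) (hX : X.Nonempty)
    (h : π.card ≤ 1) : π = {X} := by
  obtain ⟨v, hv⟩ := hX
  obtain ⟨P, hP, hvP⟩ := hπ.exists_mem hv
  have hπP : π = {P} := by
    refine eq_singleton_iff_unique_mem.2 ⟨hP, fun Q hQ => ?_⟩
    by_contra hne
    have h2 : 2 ≤ π.card := by
      have : ({Q, P} : Finset (Finset ι)) ⊆ π := by
        intro Z hZ
        rcases mem_insert.1 hZ with rfl | hZ
        · exact hQ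
        · rwa [mem_singleton.1 hZ]
      have hc := card_le_card this
      rwa [card_pair hne] at hc
    omega
  have hPX : P = X := by
    refine Subset.antisymm (hπ.subset hP) fun w hw => ?_
    obtain ⟨Q, hQ, hwQ⟩ := hπ.exists_mem hw
    rw [hπP, mem_singleton] at hQ
    exact hQ ▸ hwQ
  rw [hπP, hPX]

/-- **species A = one elementary region**: for a nonempty polymer, `¬ IsMulti X T ↔ localI X T = {X}` (the local regions partition `X`).
[cite: BalabanImbrieJaffe1988, p.304 (Sect. 5.13)] -/
theorem not_isMulti_iff {X : Finset ι} (hX : X.Nonempty) (T : Finset (Finset ι)) : ¬ IsMulti J₀ X T ↔ localI J₀ X T = {X} := by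
  rw [IsMulti, not_le]
  constructor
  · intro h
    exact eq_singleton_of_card_le_one (isSetPartition_regions _ X) hX (by omega)
  · intro h
    rw [h, card_singleton]
    exact one_lt_two

end Species

/-! ## §2 Fixed Mayer data: sets of elementary regions ↔ closed sets of cubes; the admissible fillings of `I(S)` as cube fillings -/

section Fixed

variable {J : Finset (Finset ι)} {W : Finset ι}

/-- **a union of elementary regions is closed under the merging rules** (a joining set meeting it meets one of the regions and lies, within `W`,
inside that region). [cite: BalabanImbrieJaffe1988, p.304 (Sect. 5.13)] -/
theorem isClosed_biUnion {K : Finset (Finset ι)} (hK : K ⊆ regions J W) : IsClosed J W (K.biUnion id) := by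
  intro Y hY hne y hy
  obtain ⟨k, hk⟩ := hne
  obtain ⟨hkY, hkU⟩ := mem_inter.1 hk
  obtain ⟨P, hPK, hkP⟩ := mem_biUnion.1 hkU
  obtain ⟨i, hi, rfl⟩ := mem_regions.1 (hK hPK)
  have hkW : k ∈ W := region_subset J W i hkP
  have hsub : Y ∩ W ⊆ region J W k := inter_subset_region hY hkY hkW
  rw [region_eq_of_mem hi hkP] at hsub
  exact mem_biUnion.2 ⟨region J W i, hPK, hsub hy⟩

/-- **a set of elementary regions is recovered from its cube content**: the regions contained in `∪K` are exactly the members of `K`.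
[cite: BalabanImbrieJaffe1988, p.304 (Sect. 5.13)] -/
theorem filter_subset_biUnion {K : Finset (Finset ι)} (hK : K ⊆ regions J W) :
    (regions J W).filter (· ⊆ K.biUnion id) = K := by
  ext P
  simp only [mem_filter]
  constructor
  · rintro ⟨hP, hsub⟩
    obtain ⟨v, hv⟩ := (isSetPartition_regions J W).nonempty_of_mem hP
    obtain ⟨P', hP'K, hvP'⟩ := mem_biUnion.1 (hsub hv)
    rwa [(isSetPartition_regions J W).eq_of_mem hP (hK hP'K) hv hvP']
  · intro hPK
    exact ⟨hK hPK, fun v hv => mem_biUnion.2 ⟨P, hPK, hv⟩⟩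

/-- **a closed set of cubes is the union of the elementary regions it contains.** [cite: BalabanImbrieJaffe1988, p.304 (Sect. 5.13)] -/
theorem biUnion_filter_subset {X : Finset ι} (hX : X ⊆ W) (hXc : IsClosed J W X) :
    ((regions J W).filter (· ⊆ X)).biUnion id = X := by
  ext v
  simp only [mem_biUnion, mem_filter, id]
  constructor
  · rintro ⟨P, ⟨-, hPX⟩, hvP⟩
    exact hPX hvP
  · intro hv
    exact ⟨region J W v, ⟨region_mem_regions (hX hv), region_subset_of_isClosed hX hv hXc⟩, mem_region_self (hX hv)⟩

/-- the regions inside a nonempty closed set of cubes form a nonempty family. [cite: BalabanImbrieJaffe1988, p.304 (Sect. 5.13)] -/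
theorem filter_subset_nonempty {X : Finset ι} (hX : X ⊆ W) (hXc : IsClosed J W X) (hne : X.Nonempty) :
    ((regions J W).filter (· ⊆ X)).Nonempty := by
  obtain ⟨v, hv⟩ := hne
  exact ⟨region J W v, mem_filter.2 ⟨region_mem_regions (hX hv), region_subset_of_isClosed hX hv hXc⟩⟩

/-- closedness for a union of two families of joining sets is closedness for each. [cite: BalabanImbrieJaffe1988, p.304 (Sect. 5.13)] -/
theorem isClosed_union_iff {J₁ J₂ : Finset (Finset ι)} {X : Finset ι} :
    IsClosed (J₁ ∪ J₂) W X ↔ IsClosed J₁ W X ∧ IsClosed J₂ W X := by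
  simp only [BIJ88ElementaryRegions304.IsClosed, mem_union, or_imp, forall_and]

/-- the joining sets inside `X` of a union of two families. [cite: BalabanImbrieJaffe1988, p.304 (Sect. 5.13)] -/
theorem restrictTo_union (J₁ J₂ : Finset (Finset ι)) (X : Finset ι) : restrictTo (J₁ ∪ J₂) X = restrictTo J₁ X ∪ restrictTo J₂ X :=
  filter_union _ _ _

/-- **LOCALITY of the elementary regions**: inside a polymer `X` closed under the rules `J₀ ∪ S` (all joining sets being sets of cubes of `W`),
the elementary regions of `X` for the joining sets and Mayer polymers INSIDE `X` are the global elementary regions contained in `X` — the activity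
of a cluster *"integrating over the fields in X only"* sees the same □_i. [cite: BalabanImbrieJaffe1988, p.306 (Sect. 5.13)] -/
theorem localI_eq_filter {J₀ S : Finset (Finset ι)} (hJ : ∀ Y ∈ J₀ ∪ S, Y ⊆ W) {X : Finset ι} (hX : X ⊆ W)
    (hXc : IsClosed (J₀ ∪ S) W X) : localI J₀ X (restrictTo S X) = (regions (J₀ ∪ S) W).filter (· ⊆ X) := by
  rw [localI, ← restrictTo_union, regions_restrict_of_isClosed hJ hX hXc]

variable (adj : ι → ι → Prop) [DecidableRel adj]

/-- admissibility of a cube filling relative to the GLOBAL regions of fixed Mayer data: no two distinct polymers containing ≥ 2 regions each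
contain abutting cubes. [cite: BalabanImbrieJaffe1988, (5.13.4) p.306] -/
def AdmGlob (J : Finset (Finset ι)) (W : Finset ι) (Q : Finset (Finset ι)) : Prop :=
  ∀ X ∈ Q, ∀ X' ∈ Q, X ≠ X' → 2 ≤ ((regions J W).filter (· ⊆ X)).card → 2 ≤ ((regions J W).filter (· ⊆ X')).card →
    ∀ a ∈ X, ∀ b ∈ X', ¬ adj a b

/-- decidability of `AdmGlob`. [cite: BalabanImbrieJaffe1988, (5.13.4) p.306] -/
instance instDecidableAdmGlob (J : Finset (Finset ι)) (W : Finset ι) (Q : Finset (Finset ι)) : Decidable (AdmGlob adj J W Q) :=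
  inferInstanceAs (Decidable (∀ X ∈ Q, ∀ X' ∈ Q, X ≠ X' → 2 ≤ ((regions J W).filter (· ⊆ X)).card →
    2 ≤ ((regions J W).filter (· ⊆ X')).card → ∀ a ∈ X, ∀ b ∈ X', ¬ adj a b))

variable {adj}

omit [DecidableRel adj] in
/-- the cube-content map on the admissible fillings of the regions lands in the closed admissible cube fillings.
[cite: BalabanImbrieJaffe1988, (5.13.4) p.306] -/
theorem image_biUnion_mem {P : Finset (Finset (Finset ι))} (hP : IsSetPartition (regions J W) P) (hadm : IsAdmissible (radj adj) P) :
    IsSetPartition W (P.image fun K => K.biUnion id) ∧ (∀ X ∈ P.image fun K => K.biUnion id, IsClosed J W X) ∧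
      AdmGlob adj J W (P.image fun K => K.biUnion id) := by
  have hI := isSetPartition_regions J W
  refine ⟨⟨?_, ?_, ?_, ?_⟩, ?_, ?_⟩
  · intro X hX
    obtain ⟨K, hK, rfl⟩ := mem_image.1 hX
    intro v hv
    obtain ⟨Rg, hRg, hvR⟩ := mem_biUnion.1 hv
    exact hI.subset (hP.subset hK hRg) hvR
  · intro h0
    obtain ⟨K, hK, hK0⟩ := mem_image.1 h0
    obtain ⟨Rg, hRg⟩ := hP.nonempty_of_mem hK
    obtain ⟨v, hv⟩ := hI.nonempty_of_mem (hP.subset hK hRg)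
    have : v ∈ K.biUnion id := mem_biUnion.2 ⟨Rg, hRg, hv⟩
    rw [hK0] at this
    exact notMem_empty v this
  · intro v hv
    obtain ⟨K, hK, hRK⟩ := hP.exists_mem (region_mem_regions (J := J) hv)
    exact ⟨K.biUnion id, mem_image_of_mem _ hK, mem_biUnion.2 ⟨_, hRK, mem_region_self hv⟩⟩
  · intro X hX X' hX' v hvX hvX'
    obtain ⟨K, hK, rfl⟩ := mem_image.1 hX
    obtain ⟨K', hK', rfl⟩ := mem_image.1 hX'
    obtain ⟨Rg, hRg, hvR⟩ := mem_biUnion.1 hvX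
    obtain ⟨Rg', hRg', hvR'⟩ := mem_biUnion.1 hvX'
    have hRR : Rg = Rg' := hI.eq_of_mem (hP.subset hK hRg) (hP.subset hK' hRg') hvR hvR'
    subst hRR
    rw [hP.eq_of_mem hK hK' hRg hRg']
  · intro X hX
    obtain ⟨K, hK, rfl⟩ := mem_image.1 hX
    exact isClosed_biUnion (hP.subset hK)
  · intro X hX X' hX' hne h2 h2' a ha b hb hab
    obtain ⟨K, hK, rfl⟩ := mem_image.1 hX
    obtain ⟨K', hK', rfl⟩ := mem_image.1 hX'
    rw [filter_subset_biUnion (hP.subset hK)] at h2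
    rw [filter_subset_biUnion (hP.subset hK')] at h2'
    have hKK : K ≠ K' := fun h => hne (h ▸ rfl)
    obtain ⟨Rg, hRg, haR⟩ := mem_biUnion.1 ha
    obtain ⟨Rg', hRg', hbR'⟩ := mem_biUnion.1 hb
    exact hadm K hK K' hK' hKK h2 h2' Rg hRg Rg' hRg' ⟨a, haR, b, hbR', hab⟩

omit [DecidableRel adj] in
/-- the regions-inside map on the closed admissible cube fillings lands in the admissible fillings of the regions.
[cite: BalabanImbrieJaffe1988, (5.13.4) p.306] -/
theorem image_filter_mem {Q : Finset (Finset ι)} (hQ : IsSetPartition W Q) (hcl : ∀ X ∈ Q, IsClosed J W X) (hadm : AdmGlob adj J W Q) :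
    IsSetPartition (regions J W) (Q.image fun X => (regions J W).filter (· ⊆ X)) ∧
      IsAdmissible (radj adj) (Q.image fun X => (regions J W).filter (· ⊆ X)) := by
  have hI := isSetPartition_regions J W
  refine ⟨⟨?_, ?_, ?_, ?_⟩, ?_⟩
  · intro B hB
    obtain ⟨X, -, rfl⟩ := mem_image.1 hB
    exact filter_subset _ _
  · intro h0
    obtain ⟨X, hX, hX0⟩ := mem_image.1 h0
    exact (filter_subset_nonempty (hQ.subset hX) (hcl X hX) (hQ.nonempty_of_mem hX)).ne_empty hX0
  · intro Rg hRg
    obtain ⟨i, hi, rfl⟩ := mem_regions.1 hRg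
    obtain ⟨X, hX, hiX⟩ := hQ.exists_mem hi
    exact ⟨_, mem_image_of_mem _ hX, mem_filter.2 ⟨hRg, region_subset_of_isClosed (hQ.subset hX) hiX (hcl X hX)⟩⟩
  · intro B hB B' hB' Rg hRB hRB'
    obtain ⟨X, hX, rfl⟩ := mem_image.1 hB
    obtain ⟨X', hX', rfl⟩ := mem_image.1 hB'
    obtain ⟨hRg, hRX⟩ := mem_filter.1 hRB
    obtain ⟨-, hRX'⟩ := mem_filter.1 hRB'
    obtain ⟨v, hv⟩ := hI.nonempty_of_mem hRg
    rw [hQ.eq_of_mem hX hX' (hRX hv) (hRX' hv)]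
  · intro B hB B' hB' hne h2 h2' Rg hRB Rg' hRB' ⟨a, ha, b, hb, hab⟩
    obtain ⟨X, hX, rfl⟩ := mem_image.1 hB
    obtain ⟨X', hX', rfl⟩ := mem_image.1 hB'
    have hXX : X ≠ X' := fun h => hne (h ▸ rfl)
    exact hadm X hX X' hX' hXX h2 h2' a ((mem_filter.1 hRB).2 ha) b ((mem_filter.1 hRB').2 hb) hab

/-- **The admissible fillings of the elementary regions AS CUBE FILLINGS** (fixed Mayer data; p. 306 *"{X_α} filling Λ^{(k)}_{10}"*, each `X_α`
*"a union of □_i"*): summing a weight of the cube contents over the admissible fillings of `I = regions J W` by sets of regions is summing it over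
the fillings `Q` of `W` by `J`-closed polymers in which no two distinct polymers containing ≥ 2 regions abut — the map `P ↦ {∪K : K ∈ P}` is a
bijection (inverse: `X ↦` the regions inside `X`). [cite: BalabanImbrieJaffe1988, (5.13.4) p.306] -/
theorem sum_admissible_regions_eq {R : Type*} [CommRing R] (J : Finset (Finset ι)) (W : Finset ι) (F : Finset ι → R) :
    ∑ P ∈ (setPartitions (regions J W)).filter (IsAdmissible (radj adj)), ∏ K ∈ P, F (K.biUnion id) =
      ∑ Q ∈ (setPartitions W).filter (fun Q => (∀ X ∈ Q, IsClosed J W X) ∧ AdmGlob adj J W Q), ∏ X ∈ Q, F X := by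
  refine sum_nbij' (fun P => P.image fun K => K.biUnion id) (fun Q => Q.image fun X => (regions J W).filter (· ⊆ X)) ?_ ?_ ?_ ?_ ?_
  · intro P hP
    obtain ⟨hP, hadm⟩ := mem_filter.1 hP
    rw [mem_setPartitions] at hP
    obtain ⟨h1, h2, h3⟩ := image_biUnion_mem hP hadm
    exact mem_filter.2 ⟨mem_setPartitions.2 h1, h2, h3⟩
  · intro Q hQ
    obtain ⟨hQ, hcl, hadm⟩ := mem_filter.1 hQ
    rw [mem_setPartitions] at hQ
    obtain ⟨h1, h2⟩ := image_filter_mem hQ hcl hadm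
    exact mem_filter.2 ⟨mem_setPartitions.2 h1, h2⟩
  · intro P hP
    obtain ⟨hP, -⟩ := mem_filter.1 hP
    rw [mem_setPartitions] at hP
    rw [image_image]
    conv_rhs => rw [← image_id (s := P)]
    refine image_congr fun K hK => ?_
    exact filter_subset_biUnion (hP.subset (mem_coe.1 hK))
  · intro Q hQ
    obtain ⟨hQ, hcl, -⟩ := mem_filter.1 hQ
    rw [mem_setPartitions] at hQ
    rw [image_image]
    conv_rhs => rw [← image_id (s := Q)]
    refine image_congr fun X hX => ?_
    exact biUnion_filter_subset (hQ.subset (mem_coe.1 hX)) (hcl X (mem_coe.1 hX))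
  · intro P hP
    obtain ⟨hP, -⟩ := mem_filter.1 hP
    rw [mem_setPartitions] at hP
    refine (prod_image fun K hK K' hK' h => ?_).symm
    rw [← filter_subset_biUnion (hP.subset hK), ← filter_subset_biUnion (hP.subset hK'), h]

end Fixed

/-! ## §3 The exchange of the Mayer sum with the filling sum: a two-species polymer gas -/

section Exchange

variable (adj : ι → ι → Prop) [DecidableRel adj] {R : Type*} [CommRing R] (J₀ Ys : Finset (Finset ι)) (W : Finset ι)

/-- admissibility of a cube filling relative to LOCAL Mayer data: no two distinct polymers that are multi-region for the Mayer polymers inside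
them contain abutting cubes. [cite: BalabanImbrieJaffe1988, (5.13.4) p.306] -/
def AdmLoc (S : Finset (Finset ι)) (Q : Finset (Finset ι)) : Prop :=
  ∀ X ∈ Q, ∀ X' ∈ Q, X ≠ X' → IsMulti J₀ X (restrictTo S X) → IsMulti J₀ X' (restrictTo S X') → ∀ a ∈ X, ∀ b ∈ X', ¬ adj a b

/-- decidability of `AdmLoc`. [cite: BalabanImbrieJaffe1988, (5.13.4) p.306] -/
instance instDecidableAdmLoc (S : Finset (Finset ι)) (Q : Finset (Finset ι)) : Decidable (AdmLoc adj J₀ S Q) :=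
  inferInstanceAs (Decidable (∀ X ∈ Q, ∀ X' ∈ Q, X ≠ X' → IsMulti J₀ X (restrictTo S X) → IsMulti J₀ X' (restrictTo S X') →
    ∀ a ∈ X, ∀ b ∈ X', ¬ adj a b))

variable {adj J₀ Ys W}

omit [DecidableRel adj] in
/-- under closedness, global and local admissibility agree (`localI_eq_filter`). [cite: BalabanImbrieJaffe1988, (5.13.4) p.306] -/
theorem admGlob_iff_admLoc {S : Finset (Finset ι)} (hJ : ∀ Y ∈ J₀ ∪ S, Y ⊆ W) {Q : Finset (Finset ι)} (hQ : IsSetPartition W Q)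
    (hcl : ∀ X ∈ Q, IsClosed (J₀ ∪ S) W X) : AdmGlob adj (J₀ ∪ S) W Q ↔ AdmLoc adj J₀ S Q := by
  have key : ∀ X ∈ Q, (2 ≤ ((regions (J₀ ∪ S) W).filter (· ⊆ X)).card ↔ IsMulti J₀ X (restrictTo S X)) := by
    intro X hX
    rw [IsMulti, localI_eq_filter hJ (hQ.subset hX) (hcl X hX)]
  constructor
  · intro h X hX X' hX' hne hm hm'
    exact h X hX X' hX' hne ((key X hX).2 hm) ((key X' hX').2 hm')
  · intro h X hX X' hX' hne hm hm'
    exact h X hX X' hX' hne ((key X hX).1 hm) ((key X' hX').1 hm')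

/-- **"compatible with X_α (each Y, X is contained in X_α)"**: for a filling `Q` of `W` and Mayer polymers that are nonempty sets of cubes of `W`,
every block of `Q` is closed under rules (i)–(ii) iff every Mayer polymer lies inside a block. [cite: BalabanImbrieJaffe1988, p.306 (Sect. 5.13)] -/
theorem forall_isClosed_iff_compat {S : Finset (Finset ι)} (hS : ∀ Y ∈ S, Y ⊆ W) (hne : ∀ Y ∈ S, Y.Nonempty) {Q : Finset (Finset ι)}
    (hQ : IsSetPartition W Q) : (∀ X ∈ Q, IsClosed S W X) ↔ Compat Q S := by
  constructor
  · intro h Y hY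
    obtain ⟨y, hy⟩ := hne Y hY
    obtain ⟨X, hX, hyX⟩ := hQ.exists_mem (hS Y hY hy)
    refine ⟨X, hX, fun v hv => ?_⟩
    exact h X hX Y hY ⟨y, mem_inter.2 ⟨hy, hyX⟩⟩ (mem_inter.2 ⟨hv, hS Y hY hv⟩)
  · intro h X hX Y hY hm v hv
    obtain ⟨X', hX', hYX'⟩ := h Y hY
    obtain ⟨y, hy⟩ := hm
    obtain ⟨hyY, hyX⟩ := mem_inter.1 hy
    rw [hQ.eq_of_mem hX hX' hyX (hYX' hyY)]
    exact hYX' (mem_inter.1 hv).1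

/-- the multi-region sub-family of a filling for given Mayer data. [cite: BalabanImbrieJaffe1988, (5.13.4) p.306] -/
def multiPart (J₀ S : Finset (Finset ι)) (Q : Finset (Finset ι)) : Finset (Finset ι) := Q.filter fun X => IsMulti J₀ X (restrictTo S X)

omit [DecidableRel adj] in
/-- local admissibility is the hard core on the multi-region sub-family. [cite: BalabanImbrieJaffe1988, (5.13.4) p.306] -/
theorem admLoc_iff_hardCore_multiPart (S Q : Finset (Finset ι)) : AdmLoc adj J₀ S Q ↔ HardCore adj (multiPart J₀ S Q) := by
  simp only [AdmLoc, HardCore, multiPart, mem_filter, and_imp]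
  constructor
  · intro h X hX hm X' hX' hm' hne
    exact h X hX X' hX' hne hm hm'
  · intro h X hX X' hX' hne hm hm'
    exact h X hX hm X' hX' hm' hne

/-- the species-constrained activity: `g` if the species of `X` for `T` is the one prescribed by `M`, else `0`.
[cite: BalabanImbrieJaffe1988, (5.13.4) p.306] -/
def gM (J₀ : Finset (Finset ι)) (M : Finset (Finset ι)) (g : Finset ι → Finset (Finset ι) → R) (X : Finset ι) (T : Finset (Finset ι)) : R :=
  if (IsMulti J₀ X T ↔ X ∈ M) then g X T else 0

/-- the product of the species-constrained activities is the product of the activities if `M` is the multi-region sub-family, `0` otherwise.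
[cite: BalabanImbrieJaffe1988, (5.13.4) p.306] -/
theorem prod_gM_eq (g : Finset ι → Finset (Finset ι) → R) {Q M : Finset (Finset ι)} (hM : M ⊆ Q) (S : Finset (Finset ι)) :
    ∏ X ∈ Q, gM J₀ M g X (restrictTo S X) = if multiPart J₀ S Q = M then ∏ X ∈ Q, g X (restrictTo S X) else 0 := by
  simp only [gM]
  rw [prod_ite_zero]
  congr 1
  refine propext ⟨fun h => ?_, fun h X hX => ?_⟩
  · ext X
    simp only [multiPart, mem_filter]
    constructor
    · rintro ⟨hX, hm⟩
      exact (h X hX).1 hm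
    · intro hXM
      exact ⟨hM hXM, (h X (hM hXM)).2 hXM⟩
  · rw [← h, multiPart, mem_filter]
    exact ⟨fun hm => ⟨hX, hm⟩, fun h' => h'.2⟩

/-- the resummed species-constrained activity is `gB` on `M` and `gA` off `M`. [cite: BalabanImbrieJaffe1988, (5.13.4) p.306] -/
theorem g2_gM (g : Finset ι → Finset (Finset ι) → R) (M : Finset (Finset ι)) (X : Finset ι) :
    g2 Ys (gM J₀ M g) X = if X ∈ M then gB J₀ Ys g X else gA J₀ Ys g X := by
  rw [g2]
  simp only [gM]
  split_ifs with hXM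
  · rw [gB, sum_filter]
    refine sum_congr rfl fun T _ => ?_
    simp only [hXM, iff_true]
  · rw [gA, sum_filter]
    refine sum_congr rfl fun T _ => ?_
    simp only [hXM, iff_false]

end Exchange

/-! ## §4 A supply of local, cluster-factorizing corner data on the regions (non-vacuity of the companion file's hypotheses) -/

section Supply

variable (adj : ι → ι → Prop) [DecidableRel adj] {R : Type*} [CommRing R]

/-- **local cluster-product corner data**: `zLoc w T K Λ := Π_{C ∈ clusters(K,Λ)} w (∪C) (T ∩ 𝒫(∪C))` — each decoupled cluster of regions
contributes a weight depending only on its cube content and on the Mayer polymers inside it (the shape of *"⟨·⟩_{s_Γ,X} … integrating over the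
fields in X only"* with *"f(□_i) … the factors localized in □_i"*). [cite: BalabanImbrieJaffe1988, p.306 (Sect. 5.13)] -/
def zLoc (w : Finset ι → Finset (Finset ι) → R) (T : Finset (Finset ι)) (K Λ : Finset (Finset ι)) : R :=
  zOf (radj adj) (fun C => w (C.biUnion id) (restrictTo T (C.biUnion id))) K Λ

/-- local cluster-product data are cluster-factorizing for every Mayer set (`BIJ88PolymerRep5134.isClusterFactorizing_zOf`).
[cite: BalabanImbrieJaffe1988, p.306 (Sect. 5.13)] -/
theorem isClusterFactorizing_zLoc (w : Finset ι → Finset (Finset ι) → R) (T : Finset (Finset ι)) :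
    IsClusterFactorizing (radj adj) (zLoc adj w T) :=
  isClusterFactorizing_zOf (radj adj) _

/-- restricting Mayer data to a smaller polymer in two steps is restricting in one. [cite: BalabanImbrieJaffe1988, p.306 (Sect. 5.13)] -/
theorem restrictTo_restrictTo {S : Finset (Finset ι)} {X Y : Finset ι} (hYX : Y ⊆ X) : restrictTo (restrictTo S X) Y = restrictTo S Y := by
  ext Z
  simp only [mem_restrictTo]
  exact ⟨fun ⟨⟨hZ, _⟩, hZY⟩ => ⟨hZ, hZY⟩, fun ⟨hZ, hZY⟩ => ⟨⟨hZ, hZY.trans hYX⟩, hZY⟩⟩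

/-- **local cluster-product data are local** in the sense of `hloc` (indeed on every set `K` of cube sets, not only on sets of regions): a cluster
of `K` has cube content inside `∪K`. [cite: BalabanImbrieJaffe1988, p.306 (Sect. 5.13)] -/
theorem zLoc_local (w : Finset ι → Finset (Finset ι) → R) (S : Finset (Finset ι)) (K Λ : Finset (Finset ι)) :
    zLoc adj w S K Λ = zLoc adj w (restrictTo S (K.biUnion id)) K Λ := by
  rw [zLoc, zLoc, zOf, zOf]
  refine prod_congr rfl fun C hC => ?_
  have hCK : C ⊆ K := (isSetPartition_clusters (radj adj) K Λ).subset hC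
  have hsub : C.biUnion id ⊆ K.biUnion id := biUnion_subset_biUnion_of_subset_left id hCK
  rw [restrictTo_restrictTo hsub]

end Supply

end Literature.MathematicalPhysics.QuantumFieldTheory.BalabanImbrieJaffe1984to88.BIJ88MayerExchange5134
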